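import Literature.Probability.Percolation.QuadCrossingGeneralPosition
import HarnessLib

/-!
# Rectangle quads of the plane read through a homeomorphism: the shrinking family

Support file for item `LawToCrossings` (stmt-CriticalPhenomena-14828) of route `CardyMeckeFlip`,
sub-problem `CardyFormulaZ2`.

For a homeomorphism `G : ℂ ≃ₜ ℂ` of the plane let `Quad.rectQuad G a b _ _ (fun _ => mem_univ _) ∈ 𝒬_ℂ` (informal shorthand, in the docstrings of
this file, for the tree's `Quad.rectQuad G a b _ _ _` at `D = univ`) be the quad `G ∘ rectMap a b` (the rectangle
`[-a, a] × [-b, b]` read through `G`; Schramm–Smirnov's `Q^q`).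
We record:

* `carrier_rq`, `side_zero_rq` … `side_three_rq` — carrier and sides of `rq G a b`;
* `tendsto_rq` — `rq G (a n) (b n) → rq G 1 1` in the uniform metric of `𝒬_ℂ` when
  `a n, b n → 1`;
* `iInter_crossedEvent_rq_shrink` — for `s n ↓ 0` the crossing events of the easier quads
  `rq G (1 - s n) (1 + s n)` (shorter and taller, `< rq G 1 1` in Schramm–Smirnov's order)
  decrease to `⊞_{rq G 1 1}` (configurations are closed lower sets);
* `tendsto_measure_crossedEvent_rq_shrink`, `exists_shrink_measure_crossedEvent_le` — hence,
  for every finite measure `μ` on `ℋ_ℂ`, `μ ⊞_{rq G (1-s)(1+s)} ↓ μ ⊞_{rq G 1 1}` as `s ↓ 0`: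
  the MEASURE-continuity substitute for the continuity of the Cardy value along the family, which
  is how the bridge avoids Schramm–Smirnov's Lemma 5.1 (null frontier).

References: O. Schramm, S. Smirnov, Ann. Probab. 39 (2011), §1.3 and proof of Lemma 5.1.
-/

noncomputable section

open Set Filter MeasureTheory Metric
open scoped Topology unitInterval ENNReal
open Literature.Probability.Percolation Literature.Probability.Percolation.QuadCrossing

namespace Summit.CriticalPhenomena.CardyFormulaZ2.Theorems.MeckeFlipBridge

/-! ### The quads `rq G a b` -/

/-- `rectQuad_univ_apply`: structural lemma. -/
theorem rectQuad_univ_apply (G : ℂ ≃ₜ ℂ) (a b : ℝ) (ha : 0 < a) (hb : 0 < b) (p : I × I) :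
    Quad.rectQuad G a b ha hb (fun _ => mem_univ _) p = G (Quad.rectMap a b p) := rfl

/-- The carrier of `rq G a b` is the image of the closed rectangle `[-a, a] × [-b, b]`. -/
theorem carrier_rq (G : ℂ ≃ₜ ℂ) {a b : ℝ} (ha : 0 < a) (hb : 0 < b) :
    (Quad.rectQuad G a b ha hb (fun _ => mem_univ _)).carrier = G '' (Icc (-a) a ×ℂ Icc (-b) b) := by
  rw [Quad.carrier, show ((Quad.rectQuad G a b ha hb (fun _ => mem_univ _) : Quad (univ : Set ℂ)) : I × I → ℂ) =
    G ∘ Quad.rectMap a b from rfl, range_comp, range_rectMap ha hb]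

/-- Side `0` of `rq G a b` is the image of the left side `{-a} × [-b, b]`. -/
theorem side_zero_rq (G : ℂ ≃ₜ ℂ) {a b : ℝ} (ha : 0 < a) (hb : 0 < b) :
    (Quad.rectQuad G a b ha hb (fun _ => mem_univ _)).side 0 = G '' {w : ℂ | w.re = -a ∧ w.im ∈ Icc (-b) b} := by
  change (fun p => G (Quad.rectMap a b p)) '' {z : I × I | z.1 = 0} = _
  rw [← image_image (g := G) (f := Quad.rectMap a b)]
  congr 1
  ext w
  simp only [mem_image, mem_setOf_eq, mem_Icc]
  constructor
  · rintro ⟨p, hp, rfl⟩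
    obtain ⟨h1, h2⟩ := Quad.rectMap_re_im a b p
    have hp0 : (p.1 : ℝ) = 0 := by exact_mod_cast congrArg Subtype.val hp
    have hp2 := p.2.2
    simp only [mem_Icc] at hp2
    rw [h1, h2, hp0]
    exact ⟨by ring, by nlinarith [hp2.1], by nlinarith [hp2.2]⟩
  · rintro ⟨hre, h3, h4⟩
    refine ⟨(0, ⟨(w.im / b + 1) / 2, ⟨?_, ?_⟩⟩), rfl, ?_⟩
    · have : -1 ≤ w.im / b := by rw [le_div_iff₀ hb]; linarith
      linarith
    · have : w.im / b ≤ 1 := by rw [div_le_iff₀ hb]; linarith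
      linarith
    · apply Complex.ext
      · rw [(Quad.rectMap_re_im a b _).1, hre]; norm_num
      · rw [(Quad.rectMap_re_im a b _).2]
        simp only
        field_simp
        ring

/-- Side `2` of `rq G a b` is the image of the right side `{a} × [-b, b]`. -/
theorem side_two_rq (G : ℂ ≃ₜ ℂ) {a b : ℝ} (ha : 0 < a) (hb : 0 < b) :
    (Quad.rectQuad G a b ha hb (fun _ => mem_univ _)).side 2 = G '' {w : ℂ | w.re = a ∧ w.im ∈ Icc (-b) b} := by
  change (fun p => G (Quad.rectMap a b p)) '' {z : I × I | z.1 = 1} = _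
  rw [← image_image (g := G) (f := Quad.rectMap a b)]
  congr 1
  ext w
  simp only [mem_image, mem_setOf_eq, mem_Icc]
  constructor
  · rintro ⟨p, hp, rfl⟩
    obtain ⟨h1, h2⟩ := Quad.rectMap_re_im a b p
    have hp0 : (p.1 : ℝ) = 1 := by exact_mod_cast congrArg Subtype.val hp
    have hp2 := p.2.2
    simp only [mem_Icc] at hp2
    rw [h1, h2, hp0]
    exact ⟨by ring, by nlinarith [hp2.1], by nlinarith [hp2.2]⟩
  · rintro ⟨hre, h3, h4⟩
    refine ⟨(1, ⟨(w.im / b + 1) / 2, ⟨?_, ?_⟩⟩), rfl, ?_⟩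
    · have : -1 ≤ w.im / b := by rw [le_div_iff₀ hb]; linarith
      linarith
    · have : w.im / b ≤ 1 := by rw [div_le_iff₀ hb]; linarith
      linarith
    · apply Complex.ext
      · rw [(Quad.rectMap_re_im a b _).1, hre]; norm_num
      · rw [(Quad.rectMap_re_im a b _).2]
        simp only
        field_simp
        ring

/-- Side `1` of `rq G a b` is the image of the bottom side `[-a, a] × {-b}`. -/
theorem side_one_rq (G : ℂ ≃ₜ ℂ) {a b : ℝ} (ha : 0 < a) (hb : 0 < b) :
    (Quad.rectQuad G a b ha hb (fun _ => mem_univ _)).side 1 = G '' {w : ℂ | w.im = -b ∧ w.re ∈ Icc (-a) a} := by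
  change (fun p => G (Quad.rectMap a b p)) '' {z : I × I | z.2 = 0} = _
  rw [← image_image (g := G) (f := Quad.rectMap a b)]
  congr 1
  ext w
  simp only [mem_image, mem_setOf_eq, mem_Icc]
  constructor
  · rintro ⟨p, hp, rfl⟩
    obtain ⟨h1, h2⟩ := Quad.rectMap_re_im a b p
    have hp0 : (p.2 : ℝ) = 0 := by exact_mod_cast congrArg Subtype.val hp
    have hp1 := p.1.2
    simp only [mem_Icc] at hp1
    rw [h1, h2, hp0]
    exact ⟨by ring, by nlinarith [hp1.1], by nlinarith [hp1.2]⟩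
  · rintro ⟨him, h3, h4⟩
    refine ⟨(⟨(w.re / a + 1) / 2, ⟨?_, ?_⟩⟩, 0), rfl, ?_⟩
    · have : -1 ≤ w.re / a := by rw [le_div_iff₀ ha]; linarith
      linarith
    · have : w.re / a ≤ 1 := by rw [div_le_iff₀ ha]; linarith
      linarith
    · apply Complex.ext
      · rw [(Quad.rectMap_re_im a b _).1]
        simp only
        field_simp
        ring
      · rw [(Quad.rectMap_re_im a b _).2, him]; norm_num

/-- Side `3` of `rq G a b` is the image of the top side `[-a, a] × {b}`. -/
theorem side_three_rq (G : ℂ ≃ₜ ℂ) {a b : ℝ} (ha : 0 < a) (hb : 0 < b) :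
    (Quad.rectQuad G a b ha hb (fun _ => mem_univ _)).side 3 = G '' {w : ℂ | w.im = b ∧ w.re ∈ Icc (-a) a} := by
  change (fun p => G (Quad.rectMap a b p)) '' {z : I × I | z.2 = 1} = _
  rw [← image_image (g := G) (f := Quad.rectMap a b)]
  congr 1
  ext w
  simp only [mem_image, mem_setOf_eq, mem_Icc]
  constructor
  · rintro ⟨p, hp, rfl⟩
    obtain ⟨h1, h2⟩ := Quad.rectMap_re_im a b p
    have hp0 : (p.2 : ℝ) = 1 := by exact_mod_cast congrArg Subtype.val hp
    have hp1 := p.1.2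
    simp only [mem_Icc] at hp1
    rw [h1, h2, hp0]
    exact ⟨by ring, by nlinarith [hp1.1], by nlinarith [hp1.2]⟩
  · rintro ⟨him, h3, h4⟩
    refine ⟨(⟨(w.re / a + 1) / 2, ⟨?_, ?_⟩⟩, 1), rfl, ?_⟩
    · have : -1 ≤ w.re / a := by rw [le_div_iff₀ ha]; linarith
      linarith
    · have : w.re / a ≤ 1 := by rw [div_le_iff₀ ha]; linarith
      linarith
    · apply Complex.ext
      · rw [(Quad.rectMap_re_im a b _).1]
        simp only
        field_simp
        ring
      · rw [(Quad.rectMap_re_im a b _).2, him]; norm_num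

/-! ### Convergence of `rq G a b` to `rq G 1 1` -/

/-- **The perturbed quads converge uniformly to the unperturbed one**: if `a n → 1` and
`b n → 1` then `rq G (a n) (b n) → rq G 1 1` in `𝒬_ℂ` (uniform continuity of `G` near the
square, `Quad.exists_rect_near`). -/
theorem tendsto_rq (G : ℂ ≃ₜ ℂ) {a b : ℕ → ℝ} (ha : ∀ n, 0 < a n) (hb : ∀ n, 0 < b n)
    (ha1 : Tendsto a atTop (𝓝 1)) (hb1 : Tendsto b atTop (𝓝 1)) :
    Tendsto (fun n => Quad.rectQuad G (a n) (b n) (ha n) (hb n) (fun _ => mem_univ _)) atTop (𝓝 (Quad.rectQuad G 1 1 one_pos one_pos (fun _ => mem_univ _))) := by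
  rw [Metric.tendsto_atTop]
  intro ε hε
  obtain ⟨τ, hτ, -, hroom⟩ := Quad.exists_rect_near isOpen_univ (Quad.rectQuad G 1 1 one_pos one_pos (fun _ => mem_univ _)) G
    (fun p => rfl) (half_pos hε)
  have hae : ∀ᶠ n in atTop, |a n - 1| ≤ τ := by
    have := (Metric.tendsto_atTop.1 ha1) τ hτ
    obtain ⟨N, hN⟩ := this
    exact eventually_atTop.2 ⟨N, fun n hn => (hN n hn).le⟩
  have hbe : ∀ᶠ n in atTop, |b n - 1| ≤ τ := by
    obtain ⟨N, hN⟩ := (Metric.tendsto_atTop.1 hb1) τ hτ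
    exact eventually_atTop.2 ⟨N, fun n hn => (hN n hn).le⟩
  obtain ⟨N, hN⟩ := eventually_atTop.1 (hae.and hbe)
  refine ⟨N, fun n hn => ?_⟩
  obtain ⟨h1, h2⟩ := hN n hn
  have hpt := (hroom (a n) (b n) h1 h2).2
  calc dist (Quad.rectQuad G (a n) (b n) (ha n) (hb n) (fun _ => mem_univ _)) (Quad.rectQuad G 1 1 one_pos one_pos (fun _ => mem_univ _)) ≤ ε / 2 := by
        rw [Quad.dist_eq, ContinuousMap.dist_le_iff_of_nonempty]
        exact fun p => (hpt p).le
    _ < ε := half_lt_self hε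

/-! ### The shrinking family `s ↦ rq G (1 - s) (1 + s)` -/

/-- For `0 ≤ s < s' < 1` the quad `rq G (1 - s') (1 + s')` (shorter and taller) is strictly
dominated by `rq G (1 - s) (1 + s)` in Schramm–Smirnov's order. -/
theorem strictlyDominated_rq_shrink (G : ℂ ≃ₜ ℂ) {s s' : ℝ} (hs : 0 ≤ s) (hss' : s < s')
    (hs' : s' < 1) :
    Quad.StrictlyDominated (Quad.rectQuad G (1 - s') (1 + s') (by linarith) (by linarith) (fun _ => mem_univ _))
      (Quad.rectQuad G (1 - s) (1 + s) (by linarith) (by linarith) (fun _ => mem_univ _)) :=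
  Quad.strictlyDominated_rectQuad G (by linarith) (by linarith) (by linarith) (by linarith) _ _

/-- Hence the crossing events increase along the family: `⊞_{rq G (1-s)(1+s)} ⊆ ⊞_{rq G (1-s')(1+s')}`
for `0 ≤ s ≤ s' < 1` (configurations are lower sets). -/
theorem crossedEvent_rq_shrink_mono (G : ℂ ≃ₜ ℂ) {s s' : ℝ} (hs : 0 ≤ s) (hss' : s ≤ s')
    (hs' : s' < 1) :
    QuadConfig.crossedEvent (Quad.rectQuad G (1 - s) (1 + s) (by linarith) (by linarith) (fun _ => mem_univ _)) ⊆
      QuadConfig.crossedEvent (Quad.rectQuad G (1 - s') (1 + s') (by linarith) (by linarith) (fun _ => mem_univ _)) := by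
  rcases hss'.eq_or_lt with rfl | hlt
  · exact Subset.rfl
  · exact QuadConfig.crossedEvent_subset_of_strictlyDominated
      (strictlyDominated_rq_shrink G hs hlt hs')

/-- **The crossing events of the shrinking family decrease to `⊞_{rq G 1 1}`**: for a sequence
`s n ∈ (0, 1)` tending to `0`, `⋂ n, ⊞_{rq⟨G, 1 - s n, 1 + s n⟩} = ⊞_{rq⟨G, 1, 1⟩}` — `⊇` because
each member is strictly dominated by `rq G 1 1`, `⊆` because a configuration is a closed set of
quads and `rq G (1 - s n) (1 + s n) → rq G 1 1`. -/
theorem iInter_crossedEvent_rq_shrink (G : ℂ ≃ₜ ℂ) {s : ℕ → ℝ} (hs0 : ∀ n, 0 < s n)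
    (hs1 : ∀ n, s n < 1) (hlim : Tendsto s atTop (𝓝 0)) :
    ⋂ n, QuadConfig.crossedEvent (Quad.rectQuad G (1 - s n) (1 + s n) (by linarith [hs1 n]) (by linarith [hs0 n]) (fun _ => mem_univ _)) = QuadConfig.crossedEvent (Quad.rectQuad G 1 1 one_pos one_pos (fun _ => mem_univ _)) := by
  apply Subset.antisymm
  · intro S hS
    rw [mem_iInter] at hS
    have hmem : ∀ n, Quad.rectQuad G (1 - s n) (1 + s n) (by linarith [hs1 n]) (by linarith [hs0 n]) (fun _ => mem_univ _) ∈
        (S : Set (Quad (univ : Set ℂ))) := fun n => hS n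
    have ht : Tendsto (fun n => Quad.rectQuad G (1 - s n) (1 + s n) (by linarith [hs1 n]) (by linarith [hs0 n]) (fun _ => mem_univ _)) atTop (𝓝 (Quad.rectQuad G 1 1 one_pos one_pos (fun _ => mem_univ _))) := by
      refine tendsto_rq G _ _ ?_ ?_
      · simpa using (tendsto_const_nhds (x := (1 : ℝ))).sub hlim
      · simpa using (tendsto_const_nhds (x := (1 : ℝ))).add hlim
    exact S.isClosed.mem_of_tendsto ht (Eventually.of_forall hmem)
  · intro S hS
    rw [mem_iInter]
    intro n
    have h := crossedEvent_rq_shrink_mono G le_rfl (hs0 n).le (hs1 n)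
    simp only [sub_zero, add_zero] at h
    exact h hS

/-- **Measure continuity along the shrinking family.** For a finite measure `μ` on `ℋ_ℂ` and a
strictly decreasing sequence `s n ∈ (0, 1)` tending to `0`,
`μ ⊞_{rq G (1 - s n) (1 + s n)} → μ ⊞_{rq G 1 1}`. -/
theorem tendsto_measure_crossedEvent_rq_shrink (G : ℂ ≃ₜ ℂ) (μ : Measure (QuadConfig (univ : Set ℂ)))
    [IsFiniteMeasure μ] {s : ℕ → ℝ} (hs0 : ∀ n, 0 < s n) (hs1 : ∀ n, s n < 1)
    (hanti : StrictAnti s) (hlim : Tendsto s atTop (𝓝 0)) :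
    Tendsto (fun n => μ (QuadConfig.crossedEvent (Quad.rectQuad G (1 - s n) (1 + s n) (by linarith [hs1 n]) (by linarith [hs0 n]) (fun _ => mem_univ _)))) atTop
      (𝓝 (μ (QuadConfig.crossedEvent (Quad.rectQuad G 1 1 one_pos one_pos (fun _ => mem_univ _))))) := by
  rw [← iInter_crossedEvent_rq_shrink G hs0 hs1 hlim]
  refine tendsto_measure_iInter_atTop (μ := μ)
    (s := fun n => QuadConfig.crossedEvent (Quad.rectQuad G (1 - s n) (1 + s n) (by linarith [hs1 n]) (by linarith [hs0 n]) (fun _ => mem_univ _))) (fun n =>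
    (QuadConfig.measurableSet_crossedEvent _).nullMeasurableSet) ?_ ⟨0, measure_ne_top μ _⟩
  intro m n hmn
  exact crossedEvent_rq_shrink_mono G (hs0 n).le (hanti.antitone hmn) (hs1 m)

/-- **Approximation from the easier side**: for a finite measure `μ` on `ℋ_ℂ` and `ε > 0` there
is `s ∈ (0, 1/2]` with `μ ⊞_{rq G (1 - s) (1 + s)} ≤ μ ⊞_{rq G 1 1} + ε`. -/
theorem exists_shrink_measure_crossedEvent_le (G : ℂ ≃ₜ ℂ)
    (μ : Measure (QuadConfig (univ : Set ℂ))) [IsFiniteMeasure μ] {ε : ℝ≥0∞} (hε : 0 < ε) :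
    ∃ s : ℝ, ∃ hs : 0 < s, ∃ hs' : s ≤ 1 / 2,
      μ (QuadConfig.crossedEvent (Quad.rectQuad G (1 - s) (1 + s) (by linarith) (by linarith) (fun _ => mem_univ _))) ≤
        μ (QuadConfig.crossedEvent (Quad.rectQuad G 1 1 one_pos one_pos (fun _ => mem_univ _))) + ε := by
  set s : ℕ → ℝ := fun n => 1 / ((n : ℝ) + 3) with hs_def
  have hs0 : ∀ n, 0 < s n := fun n => by rw [hs_def]; positivity
  have hs1 : ∀ n, s n < 1 := fun n => by
    rw [hs_def]
    simp only
    rw [div_lt_one (by positivity)]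
    linarith [n.cast_nonneg (α := ℝ)]
  have hs2 : ∀ n, s n ≤ 1 / 2 := fun n => by
    rw [hs_def]
    apply one_div_le_one_div_of_le (by norm_num)
    linarith [n.cast_nonneg (α := ℝ)]
  have hanti : StrictAnti s := fun m n hmn => by
    simp only [hs_def]
    apply one_div_lt_one_div_of_lt (by positivity)
    exact_mod_cast Nat.add_lt_add_right hmn 3
  have hlim : Tendsto s atTop (𝓝 0) := by
    rw [hs_def]
    have h := tendsto_one_div_add_atTop_nhds_zero_nat (𝕜 := ℝ)
    have h3 : Tendsto (fun n : ℕ => 1 / (((n + 2 : ℕ) : ℝ) + 1)) atTop (𝓝 0) :=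
      h.comp (tendsto_add_atTop_nat 2)
    refine h3.congr fun n => ?_
    push_cast
    ring_nf
  have ht := tendsto_measure_crossedEvent_rq_shrink G μ hs0 hs1 hanti hlim
  have hev : ∀ᶠ n in atTop, μ (QuadConfig.crossedEvent (Quad.rectQuad G (1 - s n) (1 + s n) (by linarith [hs1 n]) (by linarith [hs0 n]) (fun _ => mem_univ _))) ≤
      μ (QuadConfig.crossedEvent (Quad.rectQuad G 1 1 one_pos one_pos (fun _ => mem_univ _))) + ε := by
    have hlt : μ (QuadConfig.crossedEvent (Quad.rectQuad G 1 1 one_pos one_pos (fun _ => mem_univ _))) <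
        μ (QuadConfig.crossedEvent (Quad.rectQuad G 1 1 one_pos one_pos (fun _ => mem_univ _))) + ε :=
      ENNReal.lt_add_right (measure_ne_top μ _) hε.ne'
    exact (ht.eventually (Iio_mem_nhds hlt)).mono fun n hn => hn.le
  obtain ⟨n, hn⟩ := hev.exists
  exact ⟨s n, hs0 n, hs2 n, hn⟩

end Summit.CriticalPhenomena.CardyFormulaZ2.Theorems.MeckeFlipBridge

end
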